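import Literature.NumberTheory.EllipticCurves.BSDRankZeroDensityProofs
import Literature.NumberTheory.EllipticCurves.BSDRankResidualCellsProofs
import Literature.NumberTheory.EllipticCurves.BSDSelmer
import Literature.NumberTheory.EllipticCurves.LeadingTerm
import HarnessLib

/-!
# `#Sel^(p)(E/ℚ) = p` and `E(ℚ)[p] = 0` ⇒ `corank_{ℤ_p} Sel_{p^∞}(E/ℚ) = 1`; hence rank `1` AND
# analytic rank `1` below a corank-one `p`-converse — the `Sel^(p)`-currency form of the rank-one leg,
# in particular at `p = 3` (cell `b2b-bsdres`, unit `b2b-bsdres-x10` = X10 / N2 lane, GEN 28; GLUE —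
# theorems only, no definition, no named fact of its own, nothing booked)

HONEST FRAMING (run/shared/lean/b2b/bsd-rank1-residual/, verbatim in every file): the goal of the
cell is to DELETE the COMBINATION-SHAPED residual classes of the Birch–Swinnerton-Dyer formula for
ALL analytic-rank `≤ 1` elliptic curves over `ℚ` — "full BSD formula for every rank `≤ 1` curve in
class `C`" assembled STRICTLY from published theorems — so that the rank-`≤ 1` remainder becomes
exactly the CONSTRUCTION-SHAPED classes, which are TYPED (missing-input `Prop`s), NOT attempted.
This is not "finishing BSD". GLUE for the BSD-DENSITY sprint (HOME `cells/density/CONVERSION-QUEUE.md`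
v0: binder `h9` of `bsz_rankLeOne_cRank_of_pieces` and lever (γ) «a second prime `p = 3`»); sibling
of `X10/RankZeroOfTrivialPSelmer.lean` (the rank-zero leg). Nothing is priced or booked here; no
mark, tier or count of any residual class moves; the N2 class (X10b @ 3) is untouched.

## What

* `selmerCorank_eq_one_of_natCard_selmerGroup_eq` — for every elliptic curve over `ℚ` and every
  prime `p`: `#Sel^(p)(E/ℚ) = p ∧ #E(ℚ)[p] = 1 ⟹ corank_{ℤ_p} Sel_{p^∞}(E/ℚ) = 1 ∧ rank E(ℚ) ≤ 1`,
  below the Cassels–Tate pairing ONLY (`hCT = WeierstrassCurve.exists_casselsTate_pairing`,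
  Silverman X.4.14 / Cassels 1962): the tree theorem `exists_selmerRank_eq_add`
  (`s_p = t_p + corank + 2m`) with `s_p = 1`, `t_p = 0` forces `corank = 1`, `m = 0`; and
  `rank ≤ corank` (`selmerCorank_eq_mordellWeilRank_add_holds`). No parity / root number is used.
* `rank_one_and_analyticRank_one_of_natCard_selmerGroup_eq_of_converse` — the same plus ANY
  corank-one `p`-converse at `(E, p)` supplied as a hypothesis `hconv : corank = 1 → r_an = 1` and
  Gross–Zagier–Kolyvagin (`hGZK = rank_eq_analyticRank_of_analyticRank_le_one`):
  `rank E(ℚ) = 1 ∧ ord_{s=1} L(E,s) = 1 ∧ Ш(E/ℚ) finite`. The converse is a PARAMETER so that the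
  sprint's D2 seat can feed W. Zhang 2014 Thm. 1.4 (i) (PUB, being typed as
  `WZhang2014/SelmerCorankOnePConverse.lean`) at `p = 5`, or any other printed converse.
* `rank_one_and_analyticRank_one_of_natCard_selmerGroup_eq_of_bstw` — the instance with the tree's
  named fact `burungaleSkinnerTianWan_analyticRank_eq_one_of_selmerCorank_eq_one` (BSTW
  arXiv:2409.01350 Thm. 1.10: `p ∤ 2N` ordinary, (sur), (ram) — a PREPRINT, registry «literal-PRE»;
  the ONLY corank-one converse in the tree that admits `p = 3`), and its `p = 3` display
  `…_three_of_bstw` for lever (γ).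

Not claimed: anything at `p = 2`; any converse itself; nothing for the N2 class ((ram@3) fails
there identically). Axioms: the standard three.

References: J. W. S. Cassels, J. reine angew. Math. 211 (1962) [Cassels1962ArithmeticIV];
J. H. Silverman, *AEC* Thm. X.4.2, X.4.14 [SilvermanAEC2009]; T. Dokchitser, *Notes on the parity
conjecture* §2 [Dokchitser2013ParityNotes]; A. Burungale, C. Skinner, Y. Tian, X. Wan,
arXiv:2409.01350 Thm. 1.10 [BurungaleSkinnerTianWan2024]; W. Zhang, Camb. J. Math. 2 (2014)
Thm. 1.4 [WZhang2014]; H. Darmon, CBMS 101 Thm. 3.22 (GZK) [Darmon2004].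
-/

set_option autoImplicit false

noncomputable section

open scoped Classical AddSubgroup

open WeierstrassCurve Literature.NumberTheory.EllipticCurves

namespace Summit.BirchSwinnertonDyer.Rank1Residual.X10.RankOneOfPSelmerOrderP

/-! ### §1. `#Sel^(p) = p`, `E(ℚ)[p] = 0` ⇒ corank `1` (Cassels–Tate only) -/

/-- **`#Sel^(p)(E/ℚ) = p ∧ #E(ℚ)[p] = 1 ⟹ corank_{ℤ_p} Sel_{p^∞}(E/ℚ) = 1 ∧ rank E(ℚ) ≤ 1`**, for
every elliptic curve over `ℚ` and every prime `p`, below the Cassels–Tate pairing (`hCT`) only: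
`s_p = t_p + corank + 2m` (tree `exists_selmerRank_eq_add`, Dokchitser's `rk_p = rk + δ_p` with the
square finite part) with `s_p = 1`, `t_p = 0`; `rank ≤ corank` by the corank identity
(`selmerCorank_eq_mordellWeilRank_add_holds`). [cite: SilvermanAEC2009, Thm. X.4.14 and Thm. X.4.2 (a)]
[cite: Dokchitser2013ParityNotes, §2 (first display)] -/
theorem selmerCorank_eq_one_of_natCard_selmerGroup_eq
    (hCT : WeierstrassCurve.exists_casselsTate_pairing (K := ℚ))
    (W : WeierstrassCurve ℚ) [W.IsElliptic] (p : ℕ) [Fact p.Prime]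
    (hs : Nat.card (W.selmerGroup p) = p) (ht : Nat.card (W.toAffine.Point[(p : ℤ)]) = 1) :
    W.selmerCorank p = 1 ∧ W.mordellWeilRank ≤ 1 := by
  -- (`E(ℚ)[p]` elaborates against `instDecidableEqRat`, the general-field lemma against the
  -- classical instance: `convert` bridges the subsingleton `DecidableEq` argument)
  obtain ⟨m, hm⟩ := exists_selmerRank_eq_add hCT W p 1 0 (by rw [pow_one]; exact hs)
    (by rw [pow_zero]; convert ht)
  have hc : W.selmerCorank p = 1 := by omega
  refine ⟨hc, ?_⟩
  have h := W.selmerCorank_eq_mordellWeilRank_add_holds p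
  omega

/-! ### §2. Plus a corank-one `p`-converse and GZK: rank `1` and analytic rank `1` -/

/-- **`#Sel^(p)(E/ℚ) = p ∧ #E(ℚ)[p] = 1 ⟹ rank E(ℚ) = 1 ∧ ord_{s=1} L(E,s) = 1 ∧ Ш(E/ℚ) finite`,
below Cassels–Tate (`hCT`), ANY corank-one `p`-converse at `(E, p)` (`hconv`, a parameter: W. Zhang
2014 Thm. 1.4 (i) at `p ≥ 5`, BSTW Thm. 1.10 at `p ∤ 2N`, …) and Gross–Zagier–Kolyvagin (`hGZK`).**
The shape of the binder `h9` of `bsz_rankLeOne_cRank_of_pieces` once `hconv` is instantiated.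
[cite: SilvermanAEC2009, Thm. X.4.14] [cite: Darmon2004, Thm. 3.22 (= 1.14)] -/
theorem rank_one_and_analyticRank_one_of_natCard_selmerGroup_eq_of_converse
    (hCT : WeierstrassCurve.exists_casselsTate_pairing (K := ℚ))
    (hGZK : rank_eq_analyticRank_of_analyticRank_le_one)
    (W : WeierstrassCurve ℚ) [W.IsElliptic] (p : ℕ) [Fact p.Prime]
    (hconv : W.selmerCorank p = 1 → W.analyticRank = 1)
    (hs : Nat.card (W.selmerGroup p) = p) (ht : Nat.card (W.toAffine.Point[(p : ℤ)]) = 1) :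
    W.mordellWeilRank = 1 ∧ W.analyticRank = 1 ∧ Finite W.sha := by
  have han : W.analyticRank = 1 := hconv (selmerCorank_eq_one_of_natCard_selmerGroup_eq hCT W p hs ht).1
  obtain ⟨hrk, hfin⟩ := hGZK W (by rw [han])
  exact ⟨by rw [hrk, han], han, hfin⟩

/-- **The instance with Burungale–Skinner–Tian–Wan Thm. 1.10** (the tree's named fact
`burungaleSkinnerTianWan_analyticRank_eq_one_of_selmerCorank_eq_one`, arXiv:2409.01350 — a
PREPRINT, registry tier «literal-PRE»; the only corank-one converse in the tree admitting `p = 3`):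
for `E/ℚ` with globally minimal model `W`, `p ≠ 2` good ordinary, `ρ̄_{E,p}` surjective, (ram)
(a multiplicative `ℓ ≠ p` with `p ∤ v_ℓ(Δ_min)`): `#Sel^(p)(E/ℚ) = p ∧ #E(ℚ)[p] = 1 ⟹
rank E(ℚ) = 1 ∧ ord_{s=1} L(E,s) = 1 ∧ Ш(E/ℚ) finite`, below `hCT`, `hBSTW`, `hGZK`.
[cite: BurungaleSkinnerTianWan2024, Thm. 1.10] [cite: SilvermanAEC2009, Thm. X.4.14] -/
theorem rank_one_and_analyticRank_one_of_natCard_selmerGroup_eq_of_bstw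
    (hCT : WeierstrassCurve.exists_casselsTate_pairing (K := ℚ))
    (hBSTW : burungaleSkinnerTianWan_analyticRank_eq_one_of_selmerCorank_eq_one)
    (hGZK : rank_eq_analyticRank_of_analyticRank_le_one)
    (W : WeierstrassCurve ℚ) [W.IsElliptic] [W.IsGloballyMinimal] (p : ℕ) [Fact p.Prime]
    (hp : p ≠ 2) (hgood : W.HasGoodReductionAtPrime p) (hord : ¬ (p : ℤ) ∣ W.frobeniusTrace p)
    (hsurj : W.HasSurjectiveModNGaloisRep p)
    (hram : ∃ ℓ : ℕ, ∃ _ : Fact ℓ.Prime, ℓ ≠ p ∧ W.HasMultiplicativeReductionAtPrime ℓ ∧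
      ¬ p ∣ padicValInt ℓ W.minimalDiscriminantInt)
    (hs : Nat.card (W.selmerGroup p) = p) (ht : Nat.card (W.toAffine.Point[(p : ℤ)]) = 1) :
    W.mordellWeilRank = 1 ∧ W.analyticRank = 1 ∧ Finite W.sha :=
  rank_one_and_analyticRank_one_of_natCard_selmerGroup_eq_of_converse hCT hGZK W p
    (fun h1 ↦ hBSTW W p hp hgood hord hsurj hram h1) hs ht

/-! ### §3. The `p = 3` display (lever (γ), rank-one leg — «literal-PRE») -/

/-- **At `p = 3`: `#Sel^(3)(E/ℚ) = 3 ∧ #E(ℚ)[3] = 1 ⟹ rank E(ℚ) = 1 ∧ ord_{s=1} L(E,s) = 1 ∧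
Ш(E/ℚ) finite`** for `E/ℚ` good ordinary at `3` with `ρ̄_{E,3}` surjective and a multiplicative
prime `ℓ` with `3 ∤ v_ℓ(Δ_min)` — below Cassels–Tate (`hCT`, PUB), BSTW Thm. 1.10 (`hBSTW`,
PREPRINT: the number this feeds must carry «literal-PRE») and GZK (`hGZK`). The rank-one companion
of `RankZeroOfTrivialPSelmer.rank_zero_and_analyticRank_zero_of_natCard_selmerGroup_three_eq_one`.
[cite: BurungaleSkinnerTianWan2024, Thm. 1.10] [cite: SilvermanAEC2009, Thm. X.4.14] -/
theorem rank_one_and_analyticRank_one_of_natCard_selmerGroup_three_of_bstw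
    (hCT : WeierstrassCurve.exists_casselsTate_pairing (K := ℚ))
    (hBSTW : burungaleSkinnerTianWan_analyticRank_eq_one_of_selmerCorank_eq_one)
    (hGZK : rank_eq_analyticRank_of_analyticRank_le_one)
    (W : WeierstrassCurve ℚ) [W.IsElliptic] [W.IsGloballyMinimal] [Fact (Nat.Prime 3)]
    (hgood : W.HasGoodReductionAtPrime 3) (hord : ¬ (3 : ℤ) ∣ W.frobeniusTrace 3)
    (hsurj : W.HasSurjectiveModNGaloisRep 3)
    (hram : ∃ ℓ : ℕ, ∃ _ : Fact ℓ.Prime, ℓ ≠ 3 ∧ W.HasMultiplicativeReductionAtPrime ℓ ∧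
      ¬ 3 ∣ padicValInt ℓ W.minimalDiscriminantInt)
    (hs : Nat.card (W.selmerGroup 3) = 3) (ht : Nat.card (W.toAffine.Point[(3 : ℤ)]) = 1) :
    W.mordellWeilRank = 1 ∧ W.analyticRank = 1 ∧ Finite W.sha :=
  rank_one_and_analyticRank_one_of_natCard_selmerGroup_eq_of_bstw hCT hBSTW hGZK W 3 (by decide)
    hgood (by exact_mod_cast hord) hsurj hram (by exact_mod_cast hs) (by exact_mod_cast ht)

end Summit.BirchSwinnertonDyer.Rank1Residual.X10.RankOneOfPSelmerOrderP

end
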